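import Literature.NumberTheory.LFunctions.NoExceptionalZeroUpToTenPowTen
import HarnessLib

/-!
# Languasco's numerical bounds for `L(1, χ)` and the Landau–Siegel zero at prime moduli `q ≤ 10⁷`

Topic `Literature/NumberTheory/LFunctions`; namespace `Literature.NumberTheory.LFunctions`.  Typed for the
parity-realchar cell (certified-computation literature for real characters: «instrument provenance» /
comparator rows next to Watkins 2004 (`3·10⁸`, odd), Platt 2016 (`4·10⁵`), Lu–Zaman–Zhao 2026 (`10¹⁰`,
`luZamanZhao2026_theorem11` / `_corollary13`)).  Statement-first (D-0064): the printed theorems are NAMED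
FACTS `def … : Prop` (D-0014; published, not discharged here — they are the output of the author's FFT
computation of `L(1, χ)` for the `664 578` odd primes `q ≤ 10⁷`, §§2–3 of both papers, with the accuracy
analysis of §3); two PROVED remarks relate them to the tree.

## Sources, as printed

**[Languasco2023LandauSiegelNumerical]** A. Languasco, *Numerical estimates on the Landau–Siegel zero and other
related quantities*, J. Number Theory **251** (2023) 185–209 = arXiv:2301.10722v4 (the TeX macros of the
arXiv source give `\bound = 10^7`, `c₁ = 0.0124862668…`, `c₂ = 0.0091904477…`, both attained at
`q = 7105733`, `χ_□` even).  `q` an odd prime, `χ_□` «the quadratic Dirichlet character mod `q`».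
* **Theorem 1** (§1): «Let `q` be an odd prime, `q ≤ 10⁷`, let `χ_□` be the quadratic Dirichlet character
  mod `q` and let `β := β_𝓛 ∈ (0, 1)` be the Landau–Siegel zero of `𝓛`, if it exists.  We have that there
  exist two computable constants `c₁, c₂ > 0` such that `L(1, χ_□) > c₁ log q` for every `L(s, χ_□) ∈ 𝓛`,
  and `β < 1 − c₂/log q`.» with «`c₁ = min c₁(q) = 0.0124862668…` and `c₂ = min c₂(q) = 0.0091904477…`
  both attained at `q = 7105733` (`χ_□` is even)», `𝓛 = {L(s, χ_□) : χ_□ mod q, 3 ≤ q ≤ 10⁷, q prime}`.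
* **Lemma 1** (§2): «Let `q` be an odd prime, `q ≤ 10⁷` … `d₁ log q < L(1, χ_□) < d₂ log q`, where
  `d₁ = 0.0124862668…` and `d₂ = 0.6267599041…`, attained at `q = 7105733` (`χ_□` is even), respectively
  `q = 23` (`χ_□` is odd).»
* §2, the printed proof of Theorem 1: for `1 − 1/log q ≤ σ ≤ 1`, `|L′(σ, χ)| ≤ e(S(q) + (log q/q)S(χ, q))`
  (Lemma 3, Davenport's argument + Lapkova's 2018 explicit Pólya–Vinogradov, Lemma 2); «assume that
  `L(β, χ_□) = 0`.  By the mean value theorem … `β < 1 − c₂(q)/log q`, where `c₂(q) := c₁(q)/(c₃(q) + c₄(q))`».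
  The argument applies to every real zero `β < 1` of `L(s, χ_□)` (for `β < 1 − 1/log q` the conclusion is
  trivial since `c₂ < 1`), which is how part (ii) is typed below; p. 2: «our Theorem 1 is meaningful only for
  `4·10⁵ < q ≤ 10⁷`, `q` prime, and `χ_□` even» (Watkins, Platt).
[cite: Languasco2023LandauSiegelNumerical, Theorem 1, Lemma 1]

**[Languasco2021LittlewoodBounds]** A. Languasco, *Numerical verification of Littlewood's bounds for
`|L(1, χ)|`*, J. Number Theory **223** (2021) 12–34 = arXiv:2005.04664v2 (`\bound = 10^7`).  With
`M_q := max_{χ ≠ χ₀} |L(1, χ)|`, `m_q := min_{χ ≠ χ₀} |L(1, χ)|` (all non-principal `χ` mod the prime `q`),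
`f(q) := log log q − log 2 + 1/2 + 1/log log q`, `g(q) := f(q) + 14 (log log q)/log q`:
* **Theorem 1**: «Let `3 ≤ q ≤ 10⁷`, `q` be a prime number … Then we have
  `0.604599… = M₃ ≤ M_q ≤ M_{4305479} = 6.399873…`.  Moreover, we also have
  `0.325 · 2e^γ f(q) < M_q < 0.62 · 2e^γ f(q)`, where the lower bound holds just for `q ≥ 79` …»
* **Theorem 2**: «… `0.198814… = m_{991027} ≤ m_q ≤ m_{11} = 0.618351…`.  Moreover, we also have
  `(π²/(12e^γ)) · 2.35/g(q) < m_q < (π²/(12e^γ)) · 5/g(q)`, where the upper bound holds just for `q ≥ 953` …»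
[cite: Languasco2021LittlewoodBounds, Theorems 1–2]

## What is typed

* `languasco2023_lemma1` (the two-sided `L(1, χ_□)` range) and **`languasco2023_theorem1`**
  (`L(1, χ_□) > 0.0124862668 log q` and every real zero `β ∈ (0, 1)` of `L(s, χ_□)` has
  `β < 1 − 0.0091904477/log q`, all odd primes `q ≤ 10⁷`) — FACTS;
* `languasco2021_theorem1` (`M_q`), `languasco2021_theorem2` (`m_q`) — FACTS (`γ` is Mathlib's
  `Real.eulerMascheroniConstant`);
* PROVED: `languasco2023_theorem1_zeroFree_of_luZamanZhao` — part (ii) is implied (for all `q ≤ 10⁷`, not only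
  primes) by Lu–Zaman–Zhao's later `L(σ, χ) ≠ 0` for `σ ≥ 1 − 1/(5 log q)`, `q ≤ 10¹⁰` (tree:
  `luZamanZhao2026_theorem11`), since `0.0091904477 < 1/5`; `languasco2023_theorem1.lOne_lower` (projection).
  Part (i) is NOT implied by `luZamanZhao2026_corollary13` (`L(1, χ) ≥ 1/(8 log q)`): for `q ≥ 24` the bound
  `0.0124862668 log q` is the larger one.

Rounding: the printed constants are truncations («…»); lower bounds are typed with the printed digits
(implied by the source), the two UPPER numerical bounds (`d₂`, `M_{4305479}`) are typed rounded UP in the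
last printed digit (`0.6267599042`, `6.399874`) so that the typed statement is implied by the printed one.
For a prime `q` every non-principal character is primitive and `χ_□` is the unique `χ ≠ 1` with
`χ.IsQuadratic` (the Legendre symbol), which is how «the quadratic character mod `q`» is rendered;
`L` is Mathlib's `DirichletCharacter.LFunction`; `L(1, χ_□)` is real and is rendered by its real part.

`lean search` (2026-08-27): no decl mentions either paper; the constants do not occur in the tree.

## References

* [Languasco2023LandauSiegelNumerical] A. Languasco, J. Number Theory 251 (2023) 185–209,
  doi:10.1016/j.jnt.2023.04.008, arXiv:2301.10722 — Theorem 1, Lemma 1 (held: `paper:arxiv-2301.10722`).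
* [Languasco2021LittlewoodBounds] A. Languasco, J. Number Theory 223 (2021) 12–34,
  doi:10.1016/j.jnt.2020.12.017, arXiv:2005.04664 — Theorems 1–2 (held: `paper:arxiv-2005.04664`).
* [LuZamanZhao2026] R. F. Lu, A. Zaman, H. Zhao, Math. Comp. (2026), Theorem 1.1, Corollary 1.3
  (tree: `NoExceptionalZeroUpToTenPowTen.lean`).
-/

noncomputable section

namespace Literature.NumberTheory.LFunctions

/-! ### Languasco 2023: `L(1, χ_□)` and the Landau–Siegel zero for odd primes `q ≤ 10⁷` -/

/-- **Languasco 2023, Lemma 1 (as printed, §2):** «Let `q` be an odd prime, `q ≤ 10⁷`, let `χ_□` be the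
quadratic Dirichlet character mod `q`.  We have that `d₁ log q < L(1, χ_□) < d₂ log q`, where
`d₁ = 0.0124862668…` and `d₂ = 0.6267599041…`, attained at `q = 7105733` (`χ_□` is even), respectively
`q = 23` (`χ_□` is odd).»  Typed with `d₁ = 0.0124862668` and the upper constant rounded up to
`0.6267599042` (the printed digits are truncations of the attained extremal ratios); `L(1, χ_□)` rendered by
its real part.  A numerical theorem (FFT evaluation of `L(1, χ)` for all odd primes `≤ 10⁷`, §3); not
discharged here. [cite: Languasco2023LandauSiegelNumerical, Lemma 1] -/
def languasco2023_lemma1 : Prop :=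
  ∀ (q : ℕ) [NeZero q], q.Prime → q ≠ 2 → q ≤ 10 ^ 7 →
    ∀ χ : DirichletCharacter ℂ q, χ.IsQuadratic → χ ≠ 1 →
      0.0124862668 * Real.log q < (χ.LFunction 1).re ∧
        (χ.LFunction 1).re ≤ 0.6267599042 * Real.log q

/-- **Languasco 2023, Theorem 1 (as printed, §1):** «Let `q` be an odd prime, `q ≤ 10⁷`, let `χ_□` be the
quadratic Dirichlet character mod `q` and let `β := β_𝓛 ∈ (0, 1)` be the Landau–Siegel zero of `𝓛`, if it
exists.  We have that there exist two computable constants `c₁, c₂ > 0` such that `L(1, χ_□) > c₁ log q` for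
every `L(s, χ_□) ∈ 𝓛`, and `β < 1 − c₂/log q`», with «`c₁ = 0.0124862668…` and `c₂ = 0.0091904477…` both
attained at `q = 7105733` (`χ_□` is even)».  Typed: for every odd prime `q ≤ 10⁷` and the quadratic `χ ≠ 1`
mod `q`, (i) `0.0124862668 · log q < L(1, χ)` and (ii) every real zero `β ∈ (0, 1)` of `L(s, χ)` satisfies
`β < 1 − 0.0091904477/log q` (the printed proof — mean value theorem with Lemma 3 on `[1 − 1/log q, 1]` and
Lapkova's Pólya–Vinogradov — bounds every real zero `β < 1`; «meaningful only for `4·10⁵ < q ≤ 10⁷`, `q`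
prime, and `χ_□` even», p. 2).  Not discharged here. [cite: Languasco2023LandauSiegelNumerical, Theorem 1] -/
def languasco2023_theorem1 : Prop :=
  ∀ (q : ℕ) [NeZero q], q.Prime → q ≠ 2 → q ≤ 10 ^ 7 →
    ∀ χ : DirichletCharacter ℂ q, χ.IsQuadratic → χ ≠ 1 →
      0.0124862668 * Real.log q < (χ.LFunction 1).re ∧
        ∀ σ : ℝ, 0 < σ → σ < 1 → χ.LFunction σ = 0 → σ < 1 - 0.0091904477 / Real.log q

/-- Projection of Theorem 1 (i): `L(1, χ_□) > 0.0124862668 log q` for odd primes `q ≤ 10⁷`.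
[cite: Languasco2023LandauSiegelNumerical, Theorem 1] -/
theorem languasco2023_theorem1.lOne_lower (h : languasco2023_theorem1) {q : ℕ} [NeZero q]
    (hp : q.Prime) (h2 : q ≠ 2) (hq : q ≤ 10 ^ 7) {χ : DirichletCharacter ℂ q} (hquad : χ.IsQuadratic)
    (h1 : χ ≠ 1) : 0.0124862668 * Real.log q < (χ.LFunction 1).re :=
  (h q hp h2 hq χ hquad h1).1

/-- **Theorem 1 (ii) is implied by Lu–Zaman–Zhao 2026, Theorem 1.1** (tree: `luZamanZhao2026_theorem11`:
`L(σ, χ) ≠ 0` for `σ ≥ 1 − 1/(5 log q)`, every quadratic `χ` mod `q ≤ 10¹⁰`), for EVERY modulus `q ≤ 10⁷`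
(prime or not) and every real zero `σ` (no window needed), since `0.0091904477 < 1/5`.  (Languasco's paper
predates LZZ; part (i) is not implied by LZZ's Corollary 1.3.) [cite: Languasco2023LandauSiegelNumerical, Theorem 1] -/
theorem languasco2023_theorem1_zeroFree_of_luZamanZhao (h : luZamanZhao2026_theorem11) {q : ℕ} [NeZero q]
    (hq : q ≤ 10 ^ 7) (χ : DirichletCharacter ℂ q) (hquad : χ.IsQuadratic) (h1 : χ ≠ 1) {σ : ℝ}
    (hzero : χ.LFunction σ = 0) : σ < 1 - 0.0091904477 / Real.log q := by
  by_contra hle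
  rw [not_lt] at hle
  have hq10 : q ≤ 10 ^ 10 := hq.trans (by norm_num)
  have hq1 : 1 < q := by
    by_contra hq1
    rw [not_lt] at hq1
    have : q = 1 := le_antisymm hq1 (Nat.one_le_iff_ne_zero.mpr (NeZero.ne q))
    subst this
    exact h1 χ.level_one
  have hlog : 0 < Real.log q := Real.log_pos (by exact_mod_cast hq1)
  have hσ : 1 - 1 / (5 * Real.log q) ≤ σ := by
    refine le_trans ?_ hle
    have : 0.0091904477 / Real.log q ≤ 1 / (5 * Real.log q) := by
      rw [div_le_div_iff₀ hlog (by positivity)]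
      nlinarith
    linarith
  exact h q hq10 χ hquad h1 σ hσ hzero

/-! ### Languasco 2021: the extremal values `M_q`, `m_q` of `|L(1, χ)|` over non-principal `χ` mod a prime
`q ≤ 10⁷` -/

/-- Languasco's `f(q) = log log q − log 2 + 1/2 + 1/log log q` (the Lamzouri–Li–Soundararajan shape).
[cite: Languasco2021LittlewoodBounds, §1 (definition of f, g)] -/
def Languasco2021.f (q : ℕ) : ℝ :=
  Real.log (Real.log q) - Real.log 2 + 1 / 2 + 1 / Real.log (Real.log q)

/-- Languasco's `g(q) = f(q) + 14 (log log q)/log q`. [cite: Languasco2021LittlewoodBounds, §1 (definition of f, g)] -/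
def Languasco2021.g (q : ℕ) : ℝ :=
  Languasco2021.f q + 14 * Real.log (Real.log q) / Real.log q

/-- **Languasco 2021, Theorem 1 (as printed):** «Let `3 ≤ q ≤ 10⁷`, `q` be a prime number and
`M_q := max_{χ ≠ χ₀} |L(1, χ)|`.  Then we have `0.604599… = M₃ ≤ M_q ≤ M_{4305479} = 6.399873…`.  Moreover,
we also have `0.325 · 2e^γ f(q) < M_q < 0.62 · 2e^γ f(q)`, where the lower bound holds just for `q ≥ 79`.»
Typed on the characters: every non-principal `χ` mod `q` has `|L(1, χ)| ≤ 6.399874` (printed truncation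
rounded up) and `|L(1, χ)| < 0.62 · 2e^γ f(q)`; some non-principal `χ` has `|L(1, χ)| ≥ 0.604599`, and for
`q ≥ 79` some has `|L(1, χ)| > 0.325 · 2e^γ f(q)` (`γ` = `Real.eulerMascheroniConstant`).  The clause
«`0.4 < max ULI < 0.66`» is not typed.  Not discharged here. [cite: Languasco2021LittlewoodBounds, Theorem 1] -/
def languasco2021_theorem1 : Prop :=
  ∀ (q : ℕ) [NeZero q], q.Prime → q ≠ 2 → q ≤ 10 ^ 7 →
    (∀ χ : DirichletCharacter ℂ q, χ ≠ 1 →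
        ‖χ.LFunction 1‖ ≤ 6.399874 ∧
          ‖χ.LFunction 1‖ < 0.62 * (2 * Real.exp Real.eulerMascheroniConstant * Languasco2021.f q)) ∧
      (∃ χ : DirichletCharacter ℂ q, χ ≠ 1 ∧ 0.604599 ≤ ‖χ.LFunction 1‖) ∧
      (79 ≤ q → ∃ χ : DirichletCharacter ℂ q, χ ≠ 1 ∧
        0.325 * (2 * Real.exp Real.eulerMascheroniConstant * Languasco2021.f q) < ‖χ.LFunction 1‖)

/-- **Languasco 2021, Theorem 2 (as printed):** «Let `3 ≤ q ≤ 10⁷`, `q` be a prime number and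
`m_q := min_{χ ≠ χ₀} |L(1, χ)|`.  Then we have `0.198814… = m_{991027} ≤ m_q ≤ m_{11} = 0.618351…`.
Moreover, we also have `(π²/(12e^γ)) · 2.35/g(q) < m_q < (π²/(12e^γ)) · 5/g(q)`, where the upper bound holds
just for `q ≥ 953`.»  Typed on the characters: every non-principal `χ` mod `q` has `|L(1, χ)| ≥ 0.198814`
and `|L(1, χ)| > (π²/(12e^γ)) · 2.35/g(q)`; some non-principal `χ` has `|L(1, χ)| ≤ 0.618352` (printed
truncation rounded up), and for `q ≥ 953` some has `|L(1, χ)| < (π²/(12e^γ)) · 5/g(q)`.  The clause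
«`1.13 < min LLI < 2`» is not typed.  Not discharged here. [cite: Languasco2021LittlewoodBounds, Theorem 2] -/
def languasco2021_theorem2 : Prop :=
  ∀ (q : ℕ) [NeZero q], q.Prime → q ≠ 2 → q ≤ 10 ^ 7 →
    (∀ χ : DirichletCharacter ℂ q, χ ≠ 1 →
        0.198814 ≤ ‖χ.LFunction 1‖ ∧
          Real.pi ^ 2 / (12 * Real.exp Real.eulerMascheroniConstant) * (2.35 / Languasco2021.g q) <
            ‖χ.LFunction 1‖) ∧
      (∃ χ : DirichletCharacter ℂ q, χ ≠ 1 ∧ ‖χ.LFunction 1‖ ≤ 0.618352) ∧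
      (953 ≤ q → ∃ χ : DirichletCharacter ℂ q, χ ≠ 1 ∧
        ‖χ.LFunction 1‖ < Real.pi ^ 2 / (12 * Real.exp Real.eulerMascheroniConstant) * (5 / Languasco2021.g q))

/-- Projection of Theorem 2: `|L(1, χ)| ≥ 0.198814` for every non-principal `χ` modulo a prime
`3 ≤ q ≤ 10⁷` (the numerical minimum `m_{991027} = 0.198814…`). [cite: Languasco2021LittlewoodBounds, Theorem 2] -/
theorem languasco2021_theorem2.norm_lOne_ge (h : languasco2021_theorem2) {q : ℕ} [NeZero q] (hp : q.Prime)
    (h2 : q ≠ 2) (hq : q ≤ 10 ^ 7) {χ : DirichletCharacter ℂ q} (h1 : χ ≠ 1) :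
    0.198814 ≤ ‖χ.LFunction 1‖ :=
  ((h q hp h2 hq).1 χ h1).1

end Literature.NumberTheory.LFunctions
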